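import Summits.NavierStokesRegularity.NavierStokesRegularity.Theses.PerpetualPump
import Summits.NavierStokesRegularity.NavierStokesRegularity.Theorems.AveragedTypeIBlowup.Negative.NSReduction
import Summits.NavierStokesRegularity.NavierStokesRegularity.Theorems.PerpetualPumpThesisBilinearOperator
import Summits.NavierStokesRegularity.NavierStokesRegularity.Theorems.PerpetualPumpThesisLocalExistence
import Summits.NavierStokesRegularity.NavierStokesRegularity.Theorems.PerpetualPumpThesisUniqueness
import Summits.NavierStokesRegularity.NavierStokesRegularity.Theorems.PerpetualPumpThesisRestart
import Summits.NavierStokesRegularity.NavierStokesRegularity.Theorems.PerpetualPumpThesisBesovFloorBoundReduction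
import Summits.NavierStokesRegularity.NavierStokesRegularity.Theorems.PerpetualPumpThesisBesovDuhamelBound
import Summits.NavierStokesRegularity.NavierStokesRegularity.Theorems.PerpetualPumpThesisTameDuhamelBound
import Summits.NavierStokesRegularity.NavierStokesRegularity.Theorems.PerpetualPumpThesisEnvelopeUpgrade
import Summits.NavierStokesRegularity.NavierStokesRegularity.Theorems.PerpetualPumpThesisEnvelopeTightness
import Literature.Analysis.FluidPDE.TaoAveragedComplexAverageLinear
import Literature.Analysis.FluidPDE.TaoCascadeProjection
import Literature.Analysis.FunctionSpaces.LittlewoodPaley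

/-!
# Line `SketchIdeator2` (idea `besov-envelope-floor`) for crux `PerpetualPump.Thesis`
# (stmt-NavierStokesRegularity-1832) — LEAD'S RESHAPED SKELETON
# (prover-line-stmt-NavierStokesRegularity-1832-0, 2026-08-16)

Planner's skeleton: `Cruxes/Thesis/SketchIdeator2.lean` (ideator 2, round 1): measure a Type-I solution in
the multiplier-stable envelope `Ḃ⁰_{∞,1}` through the envelope amplitude
`a(t) = √(T-t) ‖u(t)‖_{Ḃ⁰_{∞,1}}`; then
`Thesis ⇐ AbstractLerayFloor ∧ EnvelopeUpgrade ∧ NoPersistentFront`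
(`thesis_of_floor_upgrade_noFront`, proved there; reproduced below as `thesis_of_parts`).

## Reshaping done by the lead (composition idea unchanged)

* The planner's perturbative stub `AbstractLerayFloor` ("smallness of the envelope amplitude at ONE time
  `t₀ < T` continues `u` past `T`") is SPLIT at the skeleton level into
  - the **`H¹⁰` continuation criterion** `H10Continuation` (an `H¹⁰_df`-mild solution that stays
    `H¹⁰`-bounded on `[0,T)` extends past `T`; every averaging datum, no symmetry / cancellation), itself
    assembled (`h10Continuation_of`, proved) from FOUR registered stubs of the `H¹⁰` local theory that Tao
    asserts after (1.15) and that the tree lacks (`Cruxes/Thesis/Disproof.lean`: `LocalExistenceFor` is the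
    standing hypothesis of `thesisWithoutRate_false_of_localExistence` / `thesisGlobal_false_of_localExistence`):
    `stub_bilinearOperator` (B̃ as an `H⁹`-valued bilinear operator, Riesz + the tame trilinear bound),
    `stub_localExistence` (Picard in `C([0,τ]; H¹⁰_df)` with lifespan uniform on `H¹⁰`-balls, for ANY
    such operator), `stub_uniqueness` (of `H¹⁰_df`-mild solutions, `L²`-Gronwall), `stub_restart`
    (semigroup gluing of a restarted solution);
  - the **Besov floor bound** `stub_besovFloorBound` (envelope amplitude `≤ ε(𝒜)` at one time ⇒ `H¹⁰`
    bounded up to `T`: the `Ḃ⁰_{∞,1}` a-priori / persistence estimate of the card's K3).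
  `abstractLerayFloor_of` (proved) recomposes them.
* `stub_envelopeUpgrade` (card K2, OPEN) and `stub_noPersistentFront` (card K1, the rigidity core, held by
  the lead) are the planner's statements VERBATIM with `envAmp`/`besovEnv` unfolded.
* Every `stub_*` is stated FULLY UNFOLDED over Mathlib + `Literature.Analysis.FluidPDE.Tao2016.*` +
  `Literature.Analysis.FunctionSpaces.{eFourierSobolevNorm, eHomBesovNorm}`, so that each lands verbatim as
  `theorem stub_<name>` in `Theorems/PerpetualPumpThesis<Stub>.lean`
  (namespace `Summit.NavierStokesRegularity.NavierStokesRegularity.Theorems.PerpetualPumpThesis`).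

## Registered stubs (7 = stubs_max)

* B  `stub_bilinearOperator` (L–XL) · E `stub_localExistence` (XL) · U `stub_uniqueness` (L) ·
  G `stub_restart` (M–L) — the `H¹⁰` local theory (TRUE; Tao 2016 §1.1 after (1.15), "standard").
* F  `stub_besovFloorBound` (XL; card K3's analytic half).
* K2 `stub_envelopeUpgrade` (OPEN, new) · K1 `stub_noPersistentFront` (OPEN core ⊇ NS Type-I exclusion; lead).

Disproof used (`Cruxes/Thesis/Disproof.lean`, cdisprove cycle 1, read 2026-08-16T06:10Z): no
`_false_without_` theorem bites the line; `thesisWithoutRate_false_of_localExistence` — the rate hypothesis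
is used (only) in K1/K2; `thesis_iff_noSymm` — symmetry is carried, inessential; `thesis_iff_eventualRate` —
consistent (F asks smallness at one time, K1 pinching on all of `[0,T)` is what `thesis_of_parts` produces);
`thesisShape_of_nonpos` — the `M ≤ 0` sector needs no stub; §5 `thesis_imp_nsTypeIExclusion` — inherited by
K1 (documented, not evaded). The four `H¹⁰`-theory stubs DISCHARGE the disproof's standing hypothesis
`LocalExistenceFor` (B+E) and make its §3c/§4a unconditional.
-/

set_option linter.dupNamespace false

noncomputable section

namespace Summit.NavierStokesRegularity.NavierStokesRegularity.Cruxes.Thesis.Lines.BesovEnvelopeFloor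

open MeasureTheory Set Filter Topology
open scoped ENNReal SchwartzMap
open Literature.Analysis.FluidPDE Literature.Analysis.FluidPDE.Tao2016
open Literature.Analysis.FunctionSpaces
open Summit.NavierStokesRegularity.NavierStokesRegularity.Theses.PerpetualPump
open Summit.NavierStokesRegularity.NavierStokesRegularity.Theorems.AveragedTypeIBlowup.Negative

/-- Local notation for `ℝ³`. -/
local notation "ℝ³" => EuclideanSpace ℝ (Fin 3)
/-- Local notation for `ℂ³`. -/
local notation "ℂ³" => EuclideanSpace ℂ (Fin 3)

/-! ## Named statements (readability of the composition; the registered stubs below are their unfoldings) -/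

/-- The property list of an **`H⁹`-valued bilinear representative** `Bop` of the averaged form of `𝒜`
with constant `K`: for `u, v ∈ H¹⁰_df`, `Bop u v` is a real divergence-free `L²` field with the TAME bound
`‖Bop u v‖_{H⁹} ≤ K ‖u‖_{H¹⁰} ‖v‖_{H¹⁰}` whose pairing against every `w ∈ H¹⁰_df` is `⟨B̃(u,v), w⟩`, and
`Bop` is bilinear (over `ℝ`) on `H¹⁰_df`. (Tao 2016, (1.14)–(1.15): `B̃ : H¹⁰_df × H¹⁰_df → (H¹⁰_df)*`
"in fact takes values in `H⁹`", the one-derivative loss of `B`.) -/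
def IsBilinearRep (𝒜 : AveragingDatum) (Bop : L2C → L2C → L2C) (K : ℝ) : Prop :=
  0 ≤ K ∧
  (∀ u v : L2C, MemH10df u → MemH10df v →
    IsReal (Bop u v) ∧ IsFourierDivFree (Bop u v) ∧
    eFourierSobolevNorm 9 (Bop u v) ≤
      ENNReal.ofReal K * eFourierSobolevNorm 10 u * eFourierSobolevNorm 10 v ∧
    ∀ w : L2C, MemH10df w → pairing (Bop u v) w = 𝒜.form u v w) ∧
  (∀ u u' v : L2C, MemH10df u → MemH10df u' → MemH10df v →
    Bop (u + u') v = Bop u v + Bop u' v ∧ Bop v (u + u') = Bop v u + Bop v u') ∧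
  (∀ (c : ℝ) (u v : L2C), MemH10df u → MemH10df v →
    Bop ((c : ℂ) • u) v = (c : ℂ) • Bop u v ∧ Bop u ((c : ℂ) • v) = (c : ℂ) • Bop u v)

/-- **B — existence of a bilinear representative** for every averaging datum. -/
def BilinearOperator : Prop :=
  ∀ 𝒜 : AveragingDatum, ∃ (Bop : L2C → L2C → L2C) (K : ℝ), IsBilinearRep 𝒜 Bop K

/-- **E — local existence in `H¹⁰_df` with lifespan uniform on `H¹⁰`-balls**, for any datum admitting a
bilinear representative: for every `R ≥ 0` there is `τ > 0` such that every `a ∈ H¹⁰_df` with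
`‖a‖_{H¹⁰} ≤ R` is the datum of an `H¹⁰_df`-mild solution on `[0,τ]` bounded by `2R+1` in `H¹⁰`. -/
def LocalExistence : Prop :=
  ∀ 𝒜 : AveragingDatum, ∀ (Bop : L2C → L2C → L2C) (K : ℝ), IsBilinearRep 𝒜 Bop K →
    ∀ R : ℝ, 0 ≤ R → ∃ τ : ℝ, 0 < τ ∧ ∀ a : L2C, MemH10df a →
      eFourierSobolevNorm 10 a ≤ ENNReal.ofReal R →
      ∃ u : ℝ → L2C, IsMildSolutionFor 𝒜.form a (Icc 0 τ) u ∧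
        ∀ t ∈ Icc 0 τ, eFourierSobolevNorm 10 (u t) ≤ ENNReal.ofReal (2 * R + 1)

/-- **U — uniqueness of `H¹⁰_df`-mild solutions** on initial segments (any datum class `a`). -/
def Uniqueness : Prop :=
  ∀ 𝒜 : AveragingDatum, ∀ (a : L2C) (T : ℝ) (u v : ℝ → L2C),
    IsMildSolutionFor 𝒜.form a (Ico 0 T) u → IsMildSolutionFor 𝒜.form a (Ico 0 T) v →
    ∀ t ∈ Ico 0 T, u t = v t

/-- **G — restart / gluing**: a mild solution on `[0,T)` continued from time `t₁ < T` by a mild solution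
from the datum `u t₁` on `[0,τ]` is a mild solution from `a` on `[0, t₁ + τ)`. -/
def Restart : Prop :=
  ∀ 𝒜 : AveragingDatum, ∀ (a : L2C) (T t₁ τ : ℝ) (u v : ℝ → L2C),
    0 ≤ t₁ → t₁ < T → 0 < τ →
    IsMildSolutionFor 𝒜.form a (Ico 0 T) u →
    IsMildSolutionFor 𝒜.form (u t₁) (Icc 0 τ) v →
    IsMildSolutionFor 𝒜.form a (Ico 0 (t₁ + τ)) (fun t => if t ≤ t₁ then u t else v (t - t₁))

/-- **The `H¹⁰` continuation criterion** (assembled from B, E, U, G below): an `H¹⁰_df`-mild solution on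
`[0,T)` from a Schwartz divergence-free datum whose `H¹⁰` norm stays bounded extends past `T`. -/
def H10Continuation : Prop :=
  ∀ 𝒜 : AveragingDatum, ∀ u₀ : 𝓢(ℝ³, ℝ³), VectorCalculus.IsDivFree ⇑u₀ → ∀ T : ℝ, 0 < T →
    ∀ u : ℝ → L2C, 𝒜.IsMildSolution (schwartzL2 u₀) (Ico 0 T) u →
    (∃ C : ℝ, ∀ t ∈ Ico 0 T, eFourierSobolevNorm 10 (u t) ≤ ENNReal.ofReal C) →
    ∃ T' : ℝ, T < T' ∧ ∃ v : ℝ → L2C,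
      𝒜.IsMildSolution (schwartzL2 u₀) (Ico 0 T') v ∧ ∀ t ∈ Ico 0 T, v t = u t

/-- **F — the Besov floor bound** (card K3, analytic half): per datum there is `ε > 0` such that an
`H¹⁰_df`-mild solution whose envelope amplitude `√(T-t₀)‖u(t₀)‖_{Ḃ⁰_{∞,1}}` is `≤ ε` at ONE time
`t₀ < T` stays `H¹⁰`-bounded on `[0,T)`. -/
def BesovFloorBound : Prop :=
  ∀ 𝒜 : AveragingDatum, ∃ ε : ℝ, 0 < ε ∧
    ∀ u₀ : 𝓢(ℝ³, ℝ³), VectorCalculus.IsDivFree ⇑u₀ → ∀ T : ℝ, 0 < T → ∀ u : ℝ → L2C,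
      𝒜.IsMildSolution (schwartzL2 u₀) (Ico 0 T) u →
      (∃ t₀ ∈ Ico 0 T, ENNReal.ofReal (Real.sqrt (T - t₀)) *
          eHomBesovNorm 0 ∞ 1 ((u t₀ : L2C) : 𝓢'(ℝ³, ℂ³)) ≤ ENNReal.ofReal ε) →
      ∃ C : ℝ, ∀ t ∈ Ico 0 T, eFourierSobolevNorm 10 (u t) ≤ ENNReal.ofReal C

/-- **The planner's `AbstractLerayFloor`** (card K3), unfolded: smallness of the envelope amplitude at one
time continues the solution past `T`. Here it is F followed by the `H¹⁰` continuation criterion. -/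
def AbstractLerayFloor : Prop :=
  ∀ 𝒜 : AveragingDatum, ∃ ε : ℝ, 0 < ε ∧
    ∀ u₀ : 𝓢(ℝ³, ℝ³), VectorCalculus.IsDivFree ⇑u₀ → ∀ T : ℝ, 0 < T → ∀ u : ℝ → L2C,
      𝒜.IsMildSolution (schwartzL2 u₀) (Ico 0 T) u →
      (∃ t₀ ∈ Ico 0 T, ENNReal.ofReal (Real.sqrt (T - t₀)) *
          eHomBesovNorm 0 ∞ 1 ((u t₀ : L2C) : 𝓢'(ℝ³, ℂ³)) ≤ ENNReal.ofReal ε) →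
      ∃ T' : ℝ, T < T' ∧ ∃ v : ℝ → L2C,
        𝒜.IsMildSolution (schwartzL2 u₀) (Ico 0 T') v ∧ ∀ t ∈ Ico 0 T, v t = u t

/-- **K2 — `EnvelopeUpgrade`** (planner's statement, unfolded): Type I in `L^∞` ⇒ Type I in the envelope. -/
def EnvelopeUpgrade : Prop :=
  ∀ 𝒜 : AveragingDatum, 𝒜.IsSymmetric → 𝒜.HasCancellation →
    ∀ u₀ : 𝓢(ℝ³, ℝ³), VectorCalculus.IsDivFree ⇑u₀ → ∀ T : ℝ, 0 < T → ∀ u : ℝ → L2C,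
      𝒜.IsMildSolution (schwartzL2 u₀) (Ico 0 T) u →
      (∃ M : ℝ, ∀ t ∈ Ico 0 T, eLpNorm (u t) ⊤ volume ≤ ENNReal.ofReal (M / Real.sqrt (T - t))) →
      ∃ M' : ℝ, ∀ t ∈ Ico 0 T, ENNReal.ofReal (Real.sqrt (T - t)) *
          eHomBesovNorm 0 ∞ 1 ((u t : L2C) : 𝓢'(ℝ³, ℂ³)) ≤ ENNReal.ofReal M'

/-- **K1 — `NoPersistentFront`** (planner's statement, unfolded; the rigidity core): no pinched envelope. -/
def NoPersistentFront : Prop :=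
  ∀ 𝒜 : AveragingDatum, 𝒜.IsSymmetric → 𝒜.HasCancellation →
    ∀ u₀ : 𝓢(ℝ³, ℝ³), VectorCalculus.IsDivFree ⇑u₀ → ∀ T : ℝ, 0 < T → ∀ u : ℝ → L2C,
      𝒜.IsMildSolution (schwartzL2 u₀) (Ico 0 T) u →
      ∀ ε M' : ℝ, 0 < ε →
        (∀ t ∈ Ico 0 T,
          ENNReal.ofReal ε ≤ ENNReal.ofReal (Real.sqrt (T - t)) *
              eHomBesovNorm 0 ∞ 1 ((u t : L2C) : 𝓢'(ℝ³, ℂ³)) ∧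
            ENNReal.ofReal (Real.sqrt (T - t)) *
              eHomBesovNorm 0 ∞ 1 ((u t : L2C) : 𝓢'(ℝ³, ℂ³)) ≤ ENNReal.ofReal M') →
        False

/-! ## The REGISTERED stubs (fully unfolded; bodies `sorry` until landed)

LANDED (cycle 1, waves 1–2): `stub_bilinearOperator` (p90601), `stub_localExistence` (p93628), `stub_uniqueness`
(p94686), `stub_restart` (p95010), and — after the reshape of `stub_besovFloorBound` into the two a-priori estimates
via the landed reduction `stub_besovFloorBound_Reduction` (p95710) — F_A `stub_besovDuhamelBound` (p107440) and
F_B `stub_tameDuhamelBound` (p119931); all imported from `Theorems/PerpetualPumpThesis*.lean` and used by name in the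
glue below; and K2 `stub_envelopeUpgrade` (p123437) — PROVED for every averaging datum (parabolic regularity, no
symmetry/cancellation/energy). HENCE the planner's `AbstractLerayFloor` (card K3), the `H¹⁰` continuation criterion AND
the envelope upgrade are THEOREMS (`abstractLerayFloor_holds`, `h10Continuation_holds`, `envelopeUpgrade_of_stub`, all
sorry-free). Open: K1 `stub_noPersistentFront` ONLY — and by the landed tightness lemma
`Theorems.PerpetualPumpThesis.stub_noPersistentFront_Tight : Thesis → K1` the crux is now EXACTLY K1
(`thesis_iff_noPersistentFront` below). -/

/-- **F_A — the Besov–Duhamel a-priori bound** (card K3, analytic half, part 1): along an `H¹⁰_df`-mild solution,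
`‖u(t)‖_{Ḃ⁰∞1} ≤ C ‖u(t₁)‖_{Ḃ⁰∞1} + C √(t-t₁) (sup_{[t₁,t]} ‖u‖_{Ḃ⁰∞1})²` (Duhamel from `t₁`, heat bounded on `Ḃ⁰_{∞,1}`,
paraproduct bound `‖e^{σΔ}B̃(f,f)‖_{Ḃ⁰∞1} ≤ C_𝒜 σ^{-1/2}‖f‖²_{Ḃ⁰∞1}`; every averaging datum). -/
def BesovDuhamelBound : Prop :=
  ∀ 𝒜 : AveragingDatum, ∃ C : ℝ, 1 ≤ C ∧ ∀ (a : L2C) (T : ℝ) (u : ℝ → L2C),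
    IsMildSolutionFor 𝒜.form a (Ico 0 T) u → ∀ t₁ t M : ℝ, 0 ≤ t₁ → t₁ ≤ t → t < T → 0 ≤ M →
    (∀ s ∈ Icc t₁ t, eHomBesovNorm 0 ⊤ 1 ((u s : L2C) : 𝓢'(ℝ³, ℂ³)) ≤ ENNReal.ofReal M) →
    eHomBesovNorm 0 ⊤ 1 ((u t : L2C) : 𝓢'(ℝ³, ℂ³)) ≤
      ENNReal.ofReal C * eHomBesovNorm 0 ⊤ 1 ((u t₁ : L2C) : 𝓢'(ℝ³, ℂ³)) +
        ENNReal.ofReal (C * Real.sqrt (t - t₁) * M ^ 2)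

/-- **F_B — the tame `H¹⁰`–Duhamel bound** (card K3, analytic half, part 2): along an `H¹⁰_df`-mild solution,
`‖u(t)‖_{H¹⁰} ≤ ‖u(t₁)‖_{H¹⁰} + C (√(t-t₁) + (t-t₁)) (sup ‖u‖_{Ḃ⁰∞1}) (sup ‖u‖_{H¹⁰})` (Duhamel, heat smoothing
`H⁹ → H¹⁰` at cost `σ^{-1/2}`, and the TAME bound `‖B̃(u,u)‖_{H⁹} ≤ C_𝒜 ‖u‖_{Ḃ⁰∞1} ‖u‖_{H¹⁰}` (Moser); every averaging datum). -/
def TameDuhamelBound : Prop :=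
  ∀ 𝒜 : AveragingDatum, ∃ C : ℝ, 0 ≤ C ∧ ∀ (a : L2C) (T : ℝ) (u : ℝ → L2C),
    IsMildSolutionFor 𝒜.form a (Ico 0 T) u → ∀ t₁ t M R : ℝ, 0 ≤ t₁ → t₁ ≤ t → t < T → 0 ≤ M → 0 ≤ R →
    (∀ s ∈ Icc t₁ t, eHomBesovNorm 0 ⊤ 1 ((u s : L2C) : 𝓢'(ℝ³, ℂ³)) ≤ ENNReal.ofReal M) →
    (∀ s ∈ Icc t₁ t, eFourierSobolevNorm 10 (u s) ≤ ENNReal.ofReal R) →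
    eFourierSobolevNorm 10 (u t) ≤
      eFourierSobolevNorm 10 (u t₁) + ENNReal.ofReal (C * (Real.sqrt (t - t₁) + (t - t₁)) * M * R)

/-- **Stub K1 (`NoPersistentFront`, unfolded; the lead's).** -/
theorem stub_noPersistentFront :
    ∀ 𝒜 : AveragingDatum, 𝒜.IsSymmetric → 𝒜.HasCancellation →
      ∀ u₀ : 𝓢(ℝ³, ℝ³), VectorCalculus.IsDivFree ⇑u₀ → ∀ T : ℝ, 0 < T → ∀ u : ℝ → L2C,
        𝒜.IsMildSolution (schwartzL2 u₀) (Ico 0 T) u →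
        ∀ ε M' : ℝ, 0 < ε →
          (∀ t ∈ Ico 0 T,
            ENNReal.ofReal ε ≤ ENNReal.ofReal (Real.sqrt (T - t)) *
                eHomBesovNorm 0 ∞ 1 ((u t : L2C) : 𝓢'(ℝ³, ℂ³)) ∧
              ENNReal.ofReal (Real.sqrt (T - t)) *
                eHomBesovNorm 0 ∞ 1 ((u t : L2C) : 𝓢'(ℝ³, ℂ³)) ≤ ENNReal.ofReal M') →
          False := by
  sorry

/-! ## Glue: the named statements from the registered stubs (definitional unfolding) -/

/-- B, LANDED (`Theorems/PerpetualPumpThesisBilinearOperator.lean`, p90601). -/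
theorem bilinearOperator_of_stub : BilinearOperator := fun 𝒜 => by
  obtain ⟨Bop, K, h0, h1, h2, h3⟩ := Theorems.PerpetualPumpThesis.stub_bilinearOperator 𝒜
  exact ⟨Bop, K, h0, h1, h2, h3⟩

/-- E, LANDED (`Theorems/PerpetualPumpThesisLocalExistence.lean`, p93628). -/
theorem localExistence_of_stub : LocalExistence :=
  fun 𝒜 Bop K h => Theorems.PerpetualPumpThesis.stub_localExistence 𝒜 Bop K h

/-- U, LANDED (`Theorems/PerpetualPumpThesisUniqueness.lean`, p94686). -/
theorem uniqueness_of_stub : Uniqueness := Theorems.PerpetualPumpThesis.stub_uniqueness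

/-- G, LANDED (`Theorems/PerpetualPumpThesisRestart.lean`, p95010). -/
theorem restart_of_stub : Restart := Theorems.PerpetualPumpThesis.stub_restart

/-- F_A, LANDED (`Theorems/PerpetualPumpThesisBesovDuhamelBound.lean`, p107440). -/
theorem besovDuhamelBound_of_stub : BesovDuhamelBound := Theorems.PerpetualPumpThesis.stub_besovDuhamelBound

/-- F_B, LANDED (`Theorems/PerpetualPumpThesisTameDuhamelBound.lean`, p119931). -/
theorem tameDuhamelBound_of_stub : TameDuhamelBound := Theorems.PerpetualPumpThesis.stub_tameDuhamelBound

/-- F from F_A + F_B by the LANDED reduction (`Theorems/PerpetualPumpThesisBesovFloorBoundReduction.lean`, p95710):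
bootstrap of the envelope from the good time (F_A), then singular Gronwall for `H¹⁰` (F_B), compactness on `[0,t₀]`. -/
theorem besovFloorBound_of_stub : BesovFloorBound :=
  fun 𝒜 => Theorems.PerpetualPumpThesis.stub_besovFloorBound_Reduction 𝒜 (besovDuhamelBound_of_stub 𝒜)
    (tameDuhamelBound_of_stub 𝒜)

/-- K2, LANDED (`Theorems/PerpetualPumpThesisEnvelopeUpgrade.lean`, p123437): PROVED for every averaging datum without symmetry,
cancellation or energy (parabolic regularity: `L^∞` Type I ⇒ envelope Type I). -/
theorem envelopeUpgrade_of_stub : EnvelopeUpgrade := Theorems.PerpetualPumpThesis.stub_envelopeUpgrade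

theorem noPersistentFront_of_stub : NoPersistentFront := stub_noPersistentFront

/-! ## The compositions (PROVED, sorry-free) -/

/-- **B + E + U + G ⇒ the `H¹⁰` continuation criterion.** Let `‖u(t)‖_{H¹⁰} ≤ C` on `[0,T)`; with
`R = max C 0` take the uniform lifespan `τ(R)` of E, restart at `t₁ = max 0 (T - τ/2)` from `u t₁` (E),
glue (G) to a mild solution on `[0, t₁ + τ) ⊋ [0,T]`, and identify it with `u` on `[0,T)` by U. -/
theorem h10Continuation_of (hB : BilinearOperator) (hE : LocalExistence) (hU : Uniqueness)
    (hG : Restart) : H10Continuation := by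
  intro 𝒜 u₀ _hdiv T hT u hu hbd
  obtain ⟨C, hC⟩ := hbd
  obtain ⟨Bop, K, hrep⟩ := hB 𝒜
  obtain ⟨τ, hτ, hloc⟩ := hE 𝒜 Bop K hrep (max C 0) (le_max_right _ _)
  set t₁ : ℝ := max 0 (T - τ / 2) with ht₁_def
  have ht₁0 : 0 ≤ t₁ := le_max_left _ _
  have ht₁T : t₁ < T := max_lt hT (by linarith)
  have hu' : IsMildSolutionFor 𝒜.form (schwartzL2 u₀) (Ico 0 T) u := hu
  have hmem : MemH10df (u t₁) := hu'.1 t₁ ⟨ht₁0, ht₁T⟩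
  have hnorm : eFourierSobolevNorm 10 (u t₁) ≤ ENNReal.ofReal (max C 0) :=
    (hC t₁ ⟨ht₁0, ht₁T⟩).trans (ENNReal.ofReal_le_ofReal (le_max_left _ _))
  obtain ⟨v, hv, -⟩ := hloc (u t₁) hmem hnorm
  have hglue := hG 𝒜 (schwartzL2 u₀) T t₁ τ u v ht₁0 ht₁T hτ hu' hv
  have hT' : T < t₁ + τ := by
    have : T - τ / 2 ≤ t₁ := le_max_right _ _
    linarith
  refine ⟨t₁ + τ, hT', fun t => if t ≤ t₁ then u t else v (t - t₁), hglue, fun t ht => ?_⟩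
  have hres : IsMildSolutionFor 𝒜.form (schwartzL2 u₀) (Ico 0 T)
      (fun t => if t ≤ t₁ then u t else v (t - t₁)) :=
    hglue.mono (Ico_subset_Ico_right hT'.le)
  exact (hU 𝒜 (schwartzL2 u₀) T u _ hu' hres t ht).symm

/-- **F + the continuation criterion ⇒ the planner's `AbstractLerayFloor`.** -/
theorem abstractLerayFloor_of (hF : BesovFloorBound) (hC : H10Continuation) : AbstractLerayFloor := by
  intro 𝒜
  obtain ⟨ε, hε, hfloor⟩ := hF 𝒜
  refine ⟨ε, hε, fun u₀ hdiv T hT u hu hdip => ?_⟩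
  exact hC 𝒜 u₀ hdiv T hT u hu (hfloor u₀ hdiv T hT u hu hdip)

/-- **The `H¹⁰` continuation criterion HOLDS** for every averaging datum (B, E, U, G landed). -/
theorem h10Continuation_holds : H10Continuation :=
  h10Continuation_of bilinearOperator_of_stub localExistence_of_stub uniqueness_of_stub restart_of_stub

/-- **The abstract Leray floor in the Besov envelope HOLDS** for every averaging datum (card K3; F_A, F_B and the
reduction landed): there is `ε(𝒜) > 0` such that an `H¹⁰_df`-mild solution from Schwartz divergence-free data whose
envelope amplitude `√(T-t₀)‖u(t₀)‖_{Ḃ⁰_{∞,1}}` is `≤ ε` at ONE time `t₀ < T` extends as a mild solution past `T`. -/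
theorem abstractLerayFloor_holds : AbstractLerayFloor :=
  abstractLerayFloor_of besovFloorBound_of_stub h10Continuation_holds

/-- **The planner's composition** (`thesis_of_floor_upgrade_noFront` of `SketchIdeator2.lean`, unfolded):
given a Type-I `u`, K2 bounds the envelope amplitude by `M'`; either it dips below the floor `ε(𝒜)` at
some `t₀` — then the floor extends `u` — or it stays pinched in `[ε, M']` on `[0,T)`, which K1 forbids. -/
theorem thesis_of_parts (hF : AbstractLerayFloor) (hU : EnvelopeUpgrade) (hN : NoPersistentFront) :
    ∀ 𝒜 : AveragingDatum, 𝒜.IsSymmetric → 𝒜.HasCancellation →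
      ∀ u₀ : 𝓢(ℝ³, ℝ³), VectorCalculus.IsDivFree ⇑u₀ → ∀ T : ℝ, 0 < T → ∀ u : ℝ → L2C,
        𝒜.IsMildSolution (schwartzL2 u₀) (Ico 0 T) u →
        (∃ M : ℝ, ∀ t ∈ Ico 0 T, eLpNorm (u t) ⊤ volume ≤ ENNReal.ofReal (M / Real.sqrt (T - t))) →
        ∃ T' : ℝ, T < T' ∧ ∃ v : ℝ → L2C,
          𝒜.IsMildSolution (schwartzL2 u₀) (Ico 0 T') v ∧ ∀ t ∈ Ico 0 T, v t = u t := by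
  intro 𝒜 hs hc u₀ hdiv T hT u hmild hrate
  obtain ⟨ε, hε, hfloor⟩ := hF 𝒜
  obtain ⟨M', hM'⟩ := hU 𝒜 hs hc u₀ hdiv T hT u hmild hrate
  by_cases hdip : ∃ t₀ ∈ Ico 0 T, ENNReal.ofReal (Real.sqrt (T - t₀)) *
      eHomBesovNorm 0 ∞ 1 ((u t₀ : L2C) : 𝓢'(ℝ³, ℂ³)) ≤ ENNReal.ofReal ε
  · exact hfloor u₀ hdiv T hT u hmild hdip
  · push Not at hdip
    exact (hN 𝒜 hs hc u₀ hdiv T hT u hmild ε M' hε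
      (fun t ht => ⟨(hdip t ht).le, hM' t ht⟩)).elim

/-- **The crux is EXACTLY K1**: `Thesis ↔ NoPersistentFront` (← : the composition with the floor and K2 discharged;
→ : the landed tightness lemma `stub_noPersistentFront_Tight`). -/
theorem thesis_iff_noPersistentFront : Theses.PerpetualPump.Thesis ↔ NoPersistentFront :=
  ⟨fun h => Theorems.PerpetualPumpThesis.stub_noPersistentFront_Tight h,
    fun hN => thesis_of_parts abstractLerayFloor_holds envelopeUpgrade_of_stub hN⟩

/-- **The skeleton theorem**: concludes the route decl `PerpetualPump.Thesis` BY NAME from the registered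
stubs — B, E, U, G, F_A, F_B, K2 landed; K1 open (the unique theorem of this file whose conclusion is the crux
constant by name). -/
theorem Thesis_of : Theses.PerpetualPump.Thesis :=
  thesis_of_parts
    abstractLerayFloor_holds envelopeUpgrade_of_stub noPersistentFront_of_stub

end Summit.NavierStokesRegularity.NavierStokesRegularity.Cruxes.Thesis.Lines.BesovEnvelopeFloor

end
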